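import Summits.ValiantsHypothesis.ValiantsHypothesis.Theorems.SymPencilSingSixClassificationToric

/-!
# Route `SymPencil` — SING-SIX CLASSIFICATION, Theorem A (T6′): every `6`-dimensional linear
# subspace of `Sing Z(per₄)` lies in a cross, has two zero rows / columns, or is an exotic
# one-zero-line family `V_λ`, `V^gr` (ᵀ) — VERBATIM port, part 8/10 (`--supports`
# stmt-ValiantsHypothesis-5674 `SdcSuperquadratic`; rung currency only, nothing here bears on `VP ≠ VNP`)

PORT NOTE (val-width-5674-w2 g0′, helper mode; director-valiant R223 (a)): part 8/10 of a VERBATIM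
port of val-idea-18 g3/g4's SORRY-FREE Theorem A of `Cruxes/SdcSuperquadratic/Lines/
sing_six_classification.lean` rev 2.6 (sha256 dfb5f805c61d14b7…; here: `iso_le_two` … `CrossZ`).
ALL mathematics and proofs are val-idea-18's (memo `SING-SIX-CLASSIFICATION.md`); the port changes
only the file split, the linear import chain, the namespace, and one-line docstrings on API lemmas.
NOT ported: the `sorry`-stubs of LIST leaves 3–5 and `sixDim_perDir_list` (leaves 3, 4 = landed
`SymPencilPerFourExoticNoSixSquares` / `SymPencilPerFourCrossFilter`; leaf 5 open).
  Cut table: see part 1 (`…Defs`).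
Honest label: Theorem A of a line, not the crux, not the LIST; `27 ≤ sdc(per₄) ≤ 29` unchanged; stmt-5674
open; `VP ≠ VNP` not moved; no summit statement is proved here. [folklore]
-/

noncomputable section
set_option linter.dupNamespace false
set_option linter.unusedVariables false
set_option linter.unusedSectionVars false

namespace Summit.ValiantsHypothesis.ValiantsHypothesis.Theorems.SymPencilSingSixClassification

open MvPolynomial Module Literature.Computability.AlgebraicComplexity
open Literature.Barriers.CriticalPhenomena.Haruspicy (fin4_cases)
variable {K : Type*} [Field K]

/-- Totally isotropic subspaces of the split form `v₀ v₃ + v₁ v₂` on `K⁴` have dimension `≤ 2`. -/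
theorem iso_le_two (V : Submodule K (Fin 4 → K)) (hV : ∀ v ∈ V, v 0 * v 3 + v 1 * v 2 = 0) :
    finrank K V ≤ 2 := by
  have hB : ∀ v ∈ V, ∀ w ∈ V, v 0 * w 3 + v 3 * w 0 + v 1 * w 2 + v 2 * w 1 = 0 := by
    intro v hv w hw
    have h := hV (v + w) (V.add_mem hv hw)
    simp only [Pi.add_apply] at h
    linear_combination h - hV v hv - hV w hw
  have key : ∀ a b : Fin 4, (∀ v ∈ V, v a = 0 → v b = 0 → v = 0) → finrank K V ≤ 2 := by
    intro a b hinj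
    obtain ⟨π, hπ_def⟩ : ∃ π : V →ₗ[K] K × K, π =
        ((LinearMap.proj a : (Fin 4 → K) →ₗ[K] K).comp V.subtype).prod
          ((LinearMap.proj b : (Fin 4 → K) →ₗ[K] K).comp V.subtype) := ⟨_, rfl⟩
    have hπ : ∀ x : V, π x = ((x : Fin 4 → K) a, (x : Fin 4 → K) b) := fun x => by
      rw [hπ_def]; rfl
    have hinj' : Function.Injective π := by
      intro x y hxy
      rw [hπ, hπ, Prod.mk.injEq] at hxy
      apply Subtype.ext
      have := hinj ((x : Fin 4 → K) - y) (V.sub_mem x.2 y.2)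
        (by rw [Pi.sub_apply, hxy.1, sub_self]) (by rw [Pi.sub_apply, hxy.2, sub_self])
      exact sub_eq_zero.mp this
    have := LinearMap.finrank_le_finrank_of_injective hinj'
    simpa using this
  by_cases h01 : ∀ v ∈ V, v 0 = 0 → v 1 = 0 → v = 0
  · exact key 0 1 h01
  by_cases h23 : ∀ v ∈ V, v 2 = 0 → v 3 = 0 → v = 0
  · exact key 2 3 h23
  push Not at h01 h23
  obtain ⟨p, hpV, hp0, hp1, hpne⟩ := h01
  obtain ⟨q, hqV, hq2, hq3, hqne⟩ := h23
  have rp : ∀ w ∈ V, p 3 * w 0 + p 2 * w 1 = 0 := fun w hw => by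
    have h := hB p hpV w hw
    rw [hp0, hp1] at h
    linear_combination h
  have rq : ∀ w ∈ V, q 0 * w 3 + q 1 * w 2 = 0 := fun w hw => by
    have h := hB q hqV w hw
    rw [hq2, hq3] at h
    linear_combination h
  have hp23 : p 2 ≠ 0 ∨ p 3 ≠ 0 := by
    by_contra h
    push Not at h
    exact hpne (funext fun i => by
      rcases fin4_cases i with rfl | rfl | rfl | rfl
      · exact hp0
      · exact hp1
      · exact h.1
      · exact h.2)
  have hq01 : q 0 ≠ 0 ∨ q 1 ≠ 0 := by
    by_contra h
    push Not at h
    exact hqne (funext fun i => by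
      rcases fin4_cases i with rfl | rfl | rfl | rfl
      · exact h.1
      · exact h.2
      · exact hq2
      · exact hq3)
  -- from `rp`: `w a' = 0 ⇒ w (other) = 0` on `{0,1}`; from `rq` likewise on `{2,3}`
  have hw01 : ∀ w ∈ V, (p 2 ≠ 0 → w 0 = 0 → w 1 = 0) ∧ (p 3 ≠ 0 → w 1 = 0 → w 0 = 0) := by
    intro w hw
    refine ⟨fun hp2 h0 => ?_, fun hp3 h1 => ?_⟩
    · have h := rp w hw
      rw [h0] at h
      have : p 2 * w 1 = 0 := by linear_combination h
      exact (mul_eq_zero.mp this).resolve_left hp2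
    · have h := rp w hw
      rw [h1] at h
      have : p 3 * w 0 = 0 := by linear_combination h
      exact (mul_eq_zero.mp this).resolve_left hp3
  have hw23 : ∀ w ∈ V, (q 0 ≠ 0 → w 2 = 0 → w 3 = 0) ∧ (q 1 ≠ 0 → w 3 = 0 → w 2 = 0) := by
    intro w hw
    refine ⟨fun hq0 h2 => ?_, fun hq1 h3 => ?_⟩
    · have h := rq w hw
      rw [h2] at h
      have : q 0 * w 3 = 0 := by linear_combination h
      exact (mul_eq_zero.mp this).resolve_left hq0
    · have h := rq w hw
      rw [h3] at h
      have : q 1 * w 2 = 0 := by linear_combination h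
      exact (mul_eq_zero.mp this).resolve_left hq1
  have fin : ∀ w : Fin 4 → K, w 0 = 0 → w 1 = 0 → w 2 = 0 → w 3 = 0 → w = 0 := by
    intro w h0 h1 h2 h3
    funext i
    rcases fin4_cases i with rfl | rfl | rfl | rfl
    · exact h0
    · exact h1
    · exact h2
    · exact h3
  rcases hp23 with hp2 | hp3 <;> rcases hq01 with hq0 | hq1
  · exact key 0 2 fun w hw h0 h2 =>
      fin w h0 ((hw01 w hw).1 hp2 h0) h2 ((hw23 w hw).1 hq0 h2)
  · exact key 0 3 fun w hw h0 h3 =>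
      fin w h0 ((hw01 w hw).1 hp2 h0) ((hw23 w hw).2 hq1 h3) h3
  · exact key 1 2 fun w hw h1 h2 =>
      fin w ((hw01 w hw).2 hp3 h1) h1 h2 ((hw23 w hw).1 hq0 h2)
  · exact key 1 3 fun w hw h1 h3 =>
      fin w ((hw01 w hw).2 hp3 h1) h1 ((hw23 w hw).2 hq1 h3) h3

/-- The `P`-block and `Q`-block coordinates of the normal anti-block. -/
def cP : Fin 4 → Fin 4 × Fin 4 := ![(0, 2), (0, 3), (1, 2), (1, 3)]
/-- Auxiliary: `cQ` (val-idea-18, SING-SIX classification). [folklore] -/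
def cQ : Fin 4 → Fin 4 × Fin 4 := ![(2, 0), (2, 1), (3, 0), (3, 1)]

/-- Auxiliary: `πP` (val-idea-18, SING-SIX classification). [folklore] -/
def πP : (Fin 4 × Fin 4 → K) →ₗ[K] (Fin 4 → K) :=
  LinearMap.pi fun k => LinearMap.proj (cP k)
/-- Auxiliary: `πQ` (val-idea-18, SING-SIX classification). [folklore] -/
def πQ : (Fin 4 × Fin 4 → K) →ₗ[K] (Fin 4 → K) :=
  LinearMap.pi fun k => LinearMap.proj (cQ k)

/-- Auxiliary: `πP_apply` (val-idea-18, SING-SIX classification). [folklore] -/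
@[simp] theorem πP_apply (x : Fin 4 × Fin 4 → K) (k : Fin 4) : πP (K := K) x k = x (cP k) := rfl
/-- Auxiliary: `πQ_apply` (val-idea-18, SING-SIX classification). [folklore] -/
@[simp] theorem πQ_apply (x : Fin 4 × Fin 4 → K) (k : Fin 4) : πQ (K := K) x k = x (cQ k) := rfl
/-- Auxiliary: `cP_0` (val-idea-18, SING-SIX classification). [folklore] -/
@[simp] theorem cP_0 : cP 0 = (0, 2) := rfl
/-- Auxiliary: `cP_1` (val-idea-18, SING-SIX classification). [folklore] -/
@[simp] theorem cP_1 : cP 1 = (0, 3) := rfl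
/-- Auxiliary: `cP_2` (val-idea-18, SING-SIX classification). [folklore] -/
@[simp] theorem cP_2 : cP 2 = (1, 2) := rfl
/-- Auxiliary: `cP_3` (val-idea-18, SING-SIX classification). [folklore] -/
@[simp] theorem cP_3 : cP 3 = (1, 3) := rfl
/-- Auxiliary: `cQ_0` (val-idea-18, SING-SIX classification). [folklore] -/
@[simp] theorem cQ_0 : cQ 0 = (2, 0) := rfl
/-- Auxiliary: `cQ_1` (val-idea-18, SING-SIX classification). [folklore] -/
@[simp] theorem cQ_1 : cQ 1 = (2, 1) := rfl
/-- Auxiliary: `cQ_2` (val-idea-18, SING-SIX classification). [folklore] -/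
@[simp] theorem cQ_2 : cQ 2 = (3, 0) := rfl
/-- Auxiliary: `cQ_3` (val-idea-18, SING-SIX classification). [folklore] -/
@[simp] theorem cQ_3 : cQ 3 = (3, 1) := rfl

/-- **ANTI-BLOCK in normal position.**  If `W ⊆ Sing` has `x (a, b) = 0` whenever
`[a ∈ {0,1}] = [b ∈ {0,1}]` (so `W` lives on `P = {0,1} × {2,3}` and `Q = {2,3} × {0,1}`), then row
`0` or row `2` vanishes on `W`, or `dim W ≤ 4`: the subpermanents `per(P)·q`, `per(Q)·p` vanish, so
(along `x ± x₀`, characteristic `≠ 2`) `Q ≡ 0`, or `P ≡ 0`, or `per(P) ≡ per(Q) ≡ 0` on `W`, and a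
totally isotropic plane of `p₁₁p₂₂ + p₁₂p₂₁` has dimension `≤ 2` (`iso_le_two`). -/
theorem anti_normal [CharZero K] {W : Submodule K (Fin 4 × Fin 4 → K)} (hS : Sing3 W)
    (h5 : 5 ≤ finrank K W)
    (hZ : ∀ x ∈ W, ∀ a b : Fin 4, ((a = 0 ∨ a = 1) ↔ (b = 0 ∨ b = 1)) → x (a, b) = 0) :
    (∀ x ∈ W, ∀ j, x (0, j) = 0) ∨ (∀ x ∈ W, ∀ j, x (2, j) = 0) := by
  -- (A) per(P)·q = 0
  have hA : ∀ x ∈ W, ∀ a b : Fin 4, (a = 2 ∨ a = 3) → (b = 0 ∨ b = 1) →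
      (x (0, 2) * x (1, 3) + x (0, 3) * x (1, 2)) * x (a, b) = 0 := by
    intro x hx a b ha hb
    have z := hZ x hx
    rcases ha with rfl | rfl <;> rcases hb with rfl | rfl
    · have t := T3_eq_zero_of_sing3 hS hx 0 1 2 (by decide) (by decide) (by decide) 1
      rw [(T3_explicit _ _ _).2.1] at t
      simp only [row_apply, z 0 0 (by decide), z 1 0 (by decide), z 2 2 (by decide),
        z 2 3 (by decide)] at t
      linear_combination t
    · have t := T3_eq_zero_of_sing3 hS hx 0 1 2 (by decide) (by decide) (by decide) 0
      rw [(T3_explicit _ _ _).1] at t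
      simp only [row_apply, z 0 1 (by decide), z 1 1 (by decide), z 2 2 (by decide),
        z 2 3 (by decide)] at t
      linear_combination t
    · have t := T3_eq_zero_of_sing3 hS hx 0 1 3 (by decide) (by decide) (by decide) 1
      rw [(T3_explicit _ _ _).2.1] at t
      simp only [row_apply, z 0 0 (by decide), z 1 0 (by decide), z 3 2 (by decide),
        z 3 3 (by decide)] at t
      linear_combination t
    · have t := T3_eq_zero_of_sing3 hS hx 0 1 3 (by decide) (by decide) (by decide) 0
      rw [(T3_explicit _ _ _).1] at t
      simp only [row_apply, z 0 1 (by decide), z 1 1 (by decide), z 3 2 (by decide),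
        z 3 3 (by decide)] at t
      linear_combination t
  -- (B) per(Q)·p = 0
  have hB : ∀ x ∈ W, ∀ a b : Fin 4, (a = 0 ∨ a = 1) → (b = 2 ∨ b = 3) →
      (x (2, 0) * x (3, 1) + x (2, 1) * x (3, 0)) * x (a, b) = 0 := by
    intro x hx a b ha hb
    have z := hZ x hx
    rcases ha with rfl | rfl <;> rcases hb with rfl | rfl
    · have t := T3_eq_zero_of_sing3 hS hx 2 3 0 (by decide) (by decide) (by decide) 3
      rw [(T3_explicit _ _ _).2.2.2] at t
      simp only [row_apply, z 2 2 (by decide), z 3 2 (by decide), z 0 0 (by decide),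
        z 0 1 (by decide)] at t
      linear_combination t
    · have t := T3_eq_zero_of_sing3 hS hx 2 3 0 (by decide) (by decide) (by decide) 2
      rw [(T3_explicit _ _ _).2.2.1] at t
      simp only [row_apply, z 2 3 (by decide), z 3 3 (by decide), z 0 0 (by decide),
        z 0 1 (by decide)] at t
      linear_combination t
    · have t := T3_eq_zero_of_sing3 hS hx 2 3 1 (by decide) (by decide) (by decide) 3
      rw [(T3_explicit _ _ _).2.2.2] at t
      simp only [row_apply, z 2 2 (by decide), z 3 2 (by decide), z 1 0 (by decide),
        z 1 1 (by decide)] at t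
      linear_combination t
    · have t := T3_eq_zero_of_sing3 hS hx 2 3 1 (by decide) (by decide) (by decide) 2
      rw [(T3_explicit _ _ _).2.2.1] at t
      simp only [row_apply, z 2 3 (by decide), z 3 3 (by decide), z 1 0 (by decide),
        z 1 1 (by decide)] at t
      linear_combination t
  -- (C) `Q ≡ 0` on `W` (⇒ row 2 vanishes) or `per(P) ≡ 0` on `W`
  by_cases hQ : ∀ x ∈ W, ∀ a b : Fin 4, (a = 2 ∨ a = 3) → (b = 0 ∨ b = 1) → x (a, b) = 0
  · right
    intro x hx j
    rcases fin4_cases j with rfl | rfl | rfl | rfl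
    · exact hQ x hx 2 0 (Or.inl rfl) (Or.inl rfl)
    · exact hQ x hx 2 1 (Or.inl rfl) (Or.inr rfl)
    · exact hZ x hx 2 2 (by decide)
    · exact hZ x hx 2 3 (by decide)
  have hP0 : ∀ x ∈ W, x (0, 2) * x (1, 3) + x (0, 3) * x (1, 2) = 0 := by
    push Not at hQ
    obtain ⟨x₀, hx₀, a, b, ha, hb, hc⟩ := hQ
    have p0 : x₀ (0, 2) * x₀ (1, 3) + x₀ (0, 3) * x₀ (1, 2) = 0 :=
      (mul_eq_zero.mp (hA x₀ hx₀ a b ha hb)).resolve_right hc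
    intro x hx
    have e0 := hA x hx a b ha hb
    have ep := hA (x + x₀) (W.add_mem hx hx₀) a b ha hb
    have em := hA (x - x₀) (W.sub_mem hx hx₀) a b ha hb
    simp only [Pi.add_apply, Pi.sub_apply] at ep em
    refine quad_kill (B := x (0, 2) * x₀ (1, 3) + x₀ (0, 2) * x (1, 3) + x (0, 3) * x₀ (1, 2) +
      x₀ (0, 3) * x (1, 2)) hc e0 p0 ?_ ?_
    · linear_combination ep
    · linear_combination em
  -- (D) `P ≡ 0` on `W` (⇒ row 0 vanishes) or `per(Q) ≡ 0` on `W`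
  by_cases hP : ∀ x ∈ W, ∀ a b : Fin 4, (a = 0 ∨ a = 1) → (b = 2 ∨ b = 3) → x (a, b) = 0
  · left
    intro x hx j
    rcases fin4_cases j with rfl | rfl | rfl | rfl
    · exact hZ x hx 0 0 (by decide)
    · exact hZ x hx 0 1 (by decide)
    · exact hP x hx 0 2 (Or.inl rfl) (Or.inl rfl)
    · exact hP x hx 0 3 (Or.inl rfl) (Or.inr rfl)
  have hQ0 : ∀ x ∈ W, x (2, 0) * x (3, 1) + x (2, 1) * x (3, 0) = 0 := by
    push Not at hP
    obtain ⟨x₀, hx₀, a, b, ha, hb, hc⟩ := hP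
    have p0 : x₀ (2, 0) * x₀ (3, 1) + x₀ (2, 1) * x₀ (3, 0) = 0 :=
      (mul_eq_zero.mp (hB x₀ hx₀ a b ha hb)).resolve_right hc
    intro x hx
    have e0 := hB x hx a b ha hb
    have ep := hB (x + x₀) (W.add_mem hx hx₀) a b ha hb
    have em := hB (x - x₀) (W.sub_mem hx hx₀) a b ha hb
    simp only [Pi.add_apply, Pi.sub_apply] at ep em
    refine quad_kill (B := x (2, 0) * x₀ (3, 1) + x₀ (2, 0) * x (3, 1) + x (2, 1) * x₀ (3, 0) +
      x₀ (2, 1) * x (3, 0)) hc e0 p0 ?_ ?_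
    · linear_combination ep
    · linear_combination em
  -- (E) both block projections are totally isotropic planes: `dim W ≤ 2 + 2`
  exfalso
  have hVP : finrank K (W.map (πP (K := K))) ≤ 2 := by
    refine iso_le_two _ fun v hv => ?_
    obtain ⟨x, hx, rfl⟩ := Submodule.mem_map.mp hv
    simpa using hP0 x hx
  have hVQ : finrank K (W.map (πQ (K := K))) ≤ 2 := by
    refine iso_le_two _ fun v hv => ?_
    obtain ⟨x, hx, rfl⟩ := Submodule.mem_map.mp hv
    simpa using hQ0 x hx
  obtain ⟨Ω, hΩ_def⟩ : ∃ Ω : W →ₗ[K] ↥(W.map (πP (K := K))) × ↥(W.map (πQ (K := K))), Ω =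
      (LinearMap.codRestrict (W.map (πP (K := K))) ((πP (K := K)).comp W.subtype)
          (fun w => Submodule.mem_map_of_mem w.2)).prod
        (LinearMap.codRestrict (W.map (πQ (K := K))) ((πQ (K := K)).comp W.subtype)
          (fun w => Submodule.mem_map_of_mem w.2)) := ⟨_, rfl⟩
  have hΩ : ∀ w : W, (((Ω w).1 : Fin 4 → K), ((Ω w).2 : Fin 4 → K)) =
      (πP (K := K) (w : Fin 4 × Fin 4 → K), πQ (K := K) (w : Fin 4 × Fin 4 → K)) := fun w => by
    rw [hΩ_def]; rfl
  have hΩinj : Function.Injective Ω := by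
    intro w w' h
    have h1 := congrArg (fun z : ↥(W.map (πP (K := K))) × ↥(W.map (πQ (K := K))) =>
      (((z.1 : Fin 4 → K)), ((z.2 : Fin 4 → K)))) h
    simp only [hΩ, Prod.mk.injEq] at h1
    obtain ⟨hPeq, hQeq⟩ := h1
    apply Subtype.ext
    funext ij
    obtain ⟨i, j⟩ := ij
    have eP := fun k => congrFun hPeq k
    have eQ := fun k => congrFun hQeq k
    simp only [πP_apply, πQ_apply] at eP eQ
    rcases fin4_cases i with rfl | rfl | rfl | rfl <;>
      rcases fin4_cases j with rfl | rfl | rfl | rfl <;>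
      first
        | exact eP 0 | exact eP 1 | exact eP 2 | exact eP 3
        | exact eQ 0 | exact eQ 1 | exact eQ 2 | exact eQ 3
        | (rw [hZ _ w.2 _ _ (by decide), hZ _ w'.2 _ _ (by decide)])
  have hle := LinearMap.finrank_le_finrank_of_injective hΩinj
  rw [Module.finrank_prod] at hle
  omega

/-- Simultaneous row/column permutation `x ↦ ((i, j) ↦ x (ρ i, γ j))` as a linear equivalence. -/
def biPermL (ρ γ : Equiv.Perm (Fin 4)) : (Fin 4 × Fin 4 → K) ≃ₗ[K] (Fin 4 × Fin 4 → K) :=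
  LinearEquiv.funCongrLeft K K (Equiv.prodCongr ρ γ)

/-- Auxiliary: `biPermL_apply` (val-idea-18, SING-SIX classification). [folklore] -/
@[simp] theorem biPermL_apply (ρ γ : Equiv.Perm (Fin 4)) (x : Fin 4 × Fin 4 → K) (i j : Fin 4) :
    biPermL ρ γ x (i, j) = x (ρ i, γ j) := rfl

/-- Auxiliary: `sing3_map_biPermL` (val-idea-18, SING-SIX classification). [folklore] -/
theorem sing3_map_biPermL {W : Submodule K (Fin 4 × Fin 4 → K)} (hS : Sing3 W)
    (ρ γ : Equiv.Perm (Fin 4)) :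
    Sing3 (W.map (biPermL (K := K) ρ γ : (Fin 4 × Fin 4 → K) →ₗ[K] (Fin 4 × Fin 4 → K))) := by
  intro y hy r c hr hc
  obtain ⟨x, hx, rfl⟩ := Submodule.mem_map.mp hy
  have key : (Matrix.of fun i j => (biPermL (K := K) ρ γ : (Fin 4 × Fin 4 → K) →ₗ[K]
      (Fin 4 × Fin 4 → K)) x (i, j)).submatrix r c =
      (Matrix.of fun i j => x (i, j)).submatrix (ρ ∘ r) (γ ∘ c) := Matrix.ext fun _ _ => rfl
  rw [key]
  exact hS x hx _ _ (ρ.injective.comp hr) (γ.injective.comp hc)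

/-- **ANTI-BLOCK, general position** (transport of `anti_normal` by `biPermL`): a zero row. -/
theorem anti_case [CharZero K] {W : Submodule K (Fin 4 × Fin 4 → K)} (hS : Sing3 W)
    (h5 : 5 ≤ finrank K W) {i₁ i₂ j₁ j₂ : Fin 4} (hi : i₁ ≠ i₂) (hj : j₁ ≠ j₂)
    (hW : ∀ x ∈ W, ∀ i j, ((i = i₁ ∨ i = i₂) ↔ (j = j₁ ∨ j = j₂)) → x (i, j) = 0) :
    ∃ i : Fin 4, ∀ x ∈ W, ∀ j : Fin 4, x (i, j) = 0 := by
  obtain ⟨ρ, hρ0, hρ1⟩ := exists_perm_zero_one hi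
  obtain ⟨γ, hγ0, hγ1⟩ := exists_perm_zero_one hj
  set L : (Fin 4 × Fin 4 → K) →ₗ[K] (Fin 4 × Fin 4 → K) :=
    (biPermL (K := K) ρ γ : (Fin 4 × Fin 4 → K) →ₗ[K] (Fin 4 × Fin 4 → K)) with hL
  have hS' : Sing3 (W.map L) := sing3_map_biPermL hS ρ γ
  have h5' : 5 ≤ finrank K (W.map L) := by
    have : finrank K (W.map L) = finrank K W := LinearEquiv.finrank_map_eq _ _
    omega
  have hZ' : ∀ y ∈ W.map L, ∀ a b : Fin 4, ((a = 0 ∨ a = 1) ↔ (b = 0 ∨ b = 1)) → y (a, b) = 0 := by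
    intro y hy a b hab
    obtain ⟨x, hx, rfl⟩ := Submodule.mem_map.mp hy
    show x (ρ a, γ b) = 0
    apply hW x hx
    rw [← hρ0, ← hρ1, ← hγ0, ← hγ1]
    simpa only [Equiv.apply_eq_iff_eq] using hab
  have back : ∀ r : Fin 4, (∀ y ∈ W.map L, ∀ j, y (r, j) = 0) → ∀ x ∈ W, ∀ j, x (ρ r, j) = 0 := by
    intro r hr x hx j
    have := hr (L x) (Submodule.mem_map_of_mem hx) (γ.symm j)
    simpa [hL] using this
  rcases anti_normal hS' h5' hZ' with h0 | h2
  · exact ⟨ρ 0, back 0 h0⟩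
  · exact ⟨ρ 2, back 2 h2⟩

/-- The four pattern submodules of Part A. -/
def RowZ (i : Fin 4) : Submodule K (Fin 4 × Fin 4 → K) where
  carrier := {x | ∀ j, x (i, j) = 0}
  add_mem' := by
    intro a b ha hb j
    simp [ha j, hb j]
  zero_mem' := by
    intro j
    simp
  smul_mem' := by
    intro r a ha j
    simp [ha j]

/-- Auxiliary: `ColZ` (val-idea-18, SING-SIX classification). [folklore] -/
def ColZ (j : Fin 4) : Submodule K (Fin 4 × Fin 4 → K) where
  carrier := {x | ∀ i, x (i, j) = 0}
  add_mem' := by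
    intro a b ha hb i
    simp [ha i, hb i]
  zero_mem' := by
    intro i
    simp
  smul_mem' := by
    intro r a ha i
    simp [ha i]

/-- Auxiliary: `CrossZ` (val-idea-18, SING-SIX classification). [folklore] -/
def CrossZ (i₀ j₀ : Fin 4) : Submodule K (Fin 4 × Fin 4 → K) where
  carrier := {x | ∀ i j, i ≠ i₀ → j ≠ j₀ → x (i, j) = 0}
  add_mem' := by
    intro a b ha hb i j hi hj
    simp [ha i j hi hj, hb i j hi hj]
  zero_mem' := by
    intro i j _ _
    simp
  smul_mem' := by
    intro r a ha i j hi hj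
    simp [ha i j hi hj]

end Summit.ValiantsHypothesis.ValiantsHypothesis.Theorems.SymPencilSingSixClassification

end
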